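import Summits.BirchSwinnertonDyer.BirchSwinnertonDyer.Theorems.SchneiderFreeAdditiveX3TwistThreeResidualPairSwap
import Summits.BirchSwinnertonDyer.BirchSwinnertonDyer.Theorems.EisensteinPrimesResidualPairFromRat
import Summits.BirchSwinnertonDyer.BirchSwinnertonDyer.Theorems.CumulativeHeegnerLeopoldtEisensteinCharacterInvariantsAtThreeCharacterCutEq
import HarnessLib

/-!
# Teichmüller pairs of rational `p`-lines, read on `E[p]`: witnesses, RIGIDITY, quotient witnesses and their DETERMINANT transfer;
# two rational lines of ONE curve carry equal-or-swapped pairs (part 1 of «the residual pair is a `ℚ`-isogeny invariant»)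

Cell `bsd-schneider-ideate`, seat `bsd-schneider-door-c5` (prover, generation 29; assembly layer; `--supports` 19177).
PARTITION: board row B6 ∩ X3 ∩ sst-twist, `r = 1`, (G-ord, `e = 2`) half at `p = 3` (2 411 pairs: 686 non-anomalous / 1 725 ANOMALOUS twists)
of `Rank1Residual.partition` — STRUCTURE LEMMAS for the anomalous twin's per-pair assembly; types-the-object-of nothing; closes none of B6's
cells (BSD NOT advanced).  bears_on: K1-door (19177 r3 `GordTwoBranchIMC`; FYI wing 20365).

## Why (see part 2, `…ResidualPairIsogenyInvariance.lean`, for the invariance itself)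

Every CHARACTER-level typed input of the Eisenstein literature is phrased «at the residual pair `(θsub, θquot)` of `E[p]`» — Teichmüller lifts
of the characters of `Γ_ℚ` on a rational `p`-line `Φ ≤ E[p]` and on `E[p]/Φ` (`KellerYin2024.IsTeichmullerLiftOn(Quot)`).  To move such inputs
between members of a `ℚ`-isogeny class (generation 28's displayed hypothesis `hab` «`W`'s pair = `V`'s characters, either order») one needs: (i)
the pair of a GIVEN line is unique (rigidity), (ii) the pairs of two DIFFERENT lines of the same curve are swapped, (iii) a way to pin the QUOTIENT
character of a line of a second curve from partial information — the determinant.  This file supplies (i)–(iii):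

* §0 `exists_witness_sub` / `exists_witness_quot` / `isTeichmullerLiftOn(_Quot)_of_witness`: the predicates read and written on the torsion TYPE
  `E[p]` (integer witnesses `a`: `σP = aP` on `Φ`; `b`: `σQ − bQ ∈ Φ` on `E[p]`); `eq_of_isTeichmullerLiftOn(_Quot)`: UNIQUENESS of the lift on a
  rational line and on its quotient (cell `bsd-line-x1`'s `IsTeichmullerLiftOnQuot.eq_of_exists_notMem` fed the witnesses `P₀ ∈ Φ ∖ 0`, `Q₀ ∈ E[p] ∖ Φ`);
  `exists_quotWitness`: every rational line has a quotient witness for every `σ` (its Teichmüller pair exists,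
  `EisensteinCharacterInvariantsAtThreeCharacterCutEq.exists_teichmullerPair_of_line`); **`forall_smul_sub_zsmul_mem_of_mul_eq_cyclotomic`**: if `σ`
  acts on the rational line `L` by `c` and `c·d ≡ χ̄_p(σ) (mod p)`, then `d` IS a quotient witness of `L` — with any quotient witness `b′`,
  generation 28's determinant lemma `intCast_mul_eq_cyclotomic_of_stableLine` gives `c·b′ ≡ χ̄_p(σ) ≡ c·d`, `c` is a unit, `b′ ≡ d`.
* §1 **`teichmullerPair_eq_or_swap_of_isRationalLine`** — ONE CURVE, TWO LINES: rational lines `Φ, Ψ ≤ E[p]` with pairs `(θ₁, θ₂)`, `(η₁, η₂)` have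
  `(η₁, η₂) = (θ₁, θ₂)` (if `Φ = Ψ`, rigidity) or `(η₁, η₂) = (θ₂, θ₁)` (if `Φ ≠ Ψ`: `Φ ⊓ Ψ = 0`, `Φ + Ψ = E[p]`; for `T ∈ Ψ` and the quotient
  witness `b` of `Φ`, `σT − bT ∈ Φ ⊓ Ψ = 0`, so `Γ_ℚ` acts on `Ψ` through `θ₂`; for `Q = P + T` and the witness `a` of `σ` on `Φ`, `σQ − aQ = σT − aT ∈ Ψ`,
  so it acts on `E[p]/Ψ` through `θ₁`).  In words: `E[p]^ss ≅ θ₁ ⊕ θ₂` read WITHOUT semisimplification — the unordered pair does not depend on the line.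

## What is here (theorems only; no definition, no named fact, no `sorry`)
Everything for `E/ℚ` (elliptic where stated) and ANY prime `p`, any coefficient set `S ⊆ ℚ̄_p`.
HONEST FRAMING: finite group theory / Galois bookkeeping over tree theorems; CONDITIONAL on nothing; nothing analytic; nothing is closed; BSD is
proved for no curve; «closes rung: none».
References: [Serre1972] §1.11 (`det ρ̄_{E,p} = χ̄_p`); [KellerYin2024] §1.4 (arXiv:2402.12781v2 TeX L1063–1086: the characters `φ, ψ`), §1.1 L441
(Teichmüller lift); [SerreLocalFields1979] II §4 Prop. 8 (uniqueness of Teichmüller representatives); [CastellaGrossiLeeSkinner2022] §1.2 (labelling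
of the pair).  Tree: cell `bsd-line-x1` `EisensteinPrimesResidualPairFromRat`; this seat p688897 (generation 28, the determinant lemma).
-/

set_option autoImplicit false
set_option linter.dupNamespace false

noncomputable section

open scoped Classical

open Field WeierstrassCurve
  Literature.NumberTheory.EllipticCurves Literature.NumberTheory.GaloisRepresentations
  Literature.NumberTheory.EllipticCurves.Rank1Residual
  Literature.NumberTheory.EllipticCurves.KellerYin2024
  Summit.BirchSwinnertonDyer.Rank1Residual.GaloisImage
  Summit.BirchSwinnertonDyer.BirchSwinnertonDyer.Theorems.ResidualLineRigidity
  Summit.BirchSwinnertonDyer.BirchSwinnertonDyer.Theorems.SchneiderFree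
  Summit.BirchSwinnertonDyer.BirchSwinnertonDyer.Theorems.SchneiderFreeAdditiveX3.TwistThreeResidualPair

namespace Summit.BirchSwinnertonDyer.BirchSwinnertonDyer.Theorems.SchneiderFreeAdditiveX3.ResidualPairIsogeny

/-! ### §0 Reading and writing the Teichmüller-pair predicates at the level of `E[p]` -/

section Read

variable {W : WeierstrassCurve ℚ} {p : ℕ} [hp : Fact p.Prime] {S : Set (PadicAlgCl p)}

/-- Reading `IsTeichmullerLiftOn` on the torsion type: for every `σ` an integer `a ≡ θ(σ) (mod 𝔪)` with `σ • P = a • P` on `Φ`.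
[cite: KellerYin2024, §1.4 (arXiv:2402.12781v2 TeX L1063–1086)] -/
theorem exists_witness_sub {Φ : AddSubgroup (geomTorsion W (p : ℤ))}
    {θ : FramedGaloisRep ℚ (padicCoeffIntegers S) 1}
    (h : IsTeichmullerLiftOn S (Φ.map (geomTorsion W (p : ℤ)).subtype) θ) (σ : absoluteGaloisGroup ℚ) :
    ∃ a : ℤ, ‖((entry S θ σ : padicCoeffIntegers S) : PadicAlgCl p) - (a : PadicAlgCl p)‖ < 1 ∧
      ∀ P ∈ Φ, σ • P = a • P := by
  obtain ⟨a, ha, hmem⟩ := h.exists_smul_eq σ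
  refine ⟨a, ha, fun P hP ↦ Subtype.ext ?_⟩
  have h := hmem ((P : geomTorsion W (p : ℤ)) : geomPoints W) ⟨P, hP, rfl⟩
  rw [AddSubgroup.torsionBy.coe_smul, AddSubgroupClass.coe_zsmul]
  exact h

/-- Reading `IsTeichmullerLiftOnQuot` on the torsion type: for every `σ` an integer `b ≡ θ(σ) (mod 𝔪)` with `σ • Q − b • Q ∈ Φ` on `E[p]`.
[cite: KellerYin2024, §1.4 (arXiv:2402.12781v2 TeX L1063–1086)] -/
theorem exists_witness_quot {Φ : AddSubgroup (geomTorsion W (p : ℤ))}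
    {θ : FramedGaloisRep ℚ (padicCoeffIntegers S) 1}
    (h : IsTeichmullerLiftOnQuot S (Φ.map (geomTorsion W (p : ℤ)).subtype) (geomTorsion W (p : ℤ)) θ)
    (σ : absoluteGaloisGroup ℚ) :
    ∃ b : ℤ, ‖((entry S θ σ : padicCoeffIntegers S) : PadicAlgCl p) - (b : PadicAlgCl p)‖ < 1 ∧
      ∀ Q : geomTorsion W (p : ℤ), σ • Q - b • Q ∈ Φ := by
  obtain ⟨b, hb, hmem⟩ := h.2 σ
  refine ⟨b, hb, fun Q ↦ ?_⟩
  obtain ⟨R, hR, hRQ⟩ := hmem (Q : geomPoints W) Q.2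
  have hRQ' : R = σ • Q - b • Q := Subtype.ext (by
    rw [AddSubgroup.coe_subtype] at hRQ
    rw [hRQ, AddSubgroupClass.coe_sub, AddSubgroup.torsionBy.coe_smul, AddSubgroupClass.coe_zsmul])
  exact hRQ' ▸ hR

/-- Writing `IsTeichmullerLiftOn` from torsion-level witnesses. [cite: KellerYin2024, §1.4 (arXiv:2402.12781v2 TeX L1063–1086)] -/
theorem isTeichmullerLiftOn_of_witness {Φ : AddSubgroup (geomTorsion W (p : ℤ))}
    {θ : FramedGaloisRep ℚ (padicCoeffIntegers S) 1} (hpow : ∀ σ : absoluteGaloisGroup ℚ, θ σ ^ (p - 1) = 1)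
    (h : ∀ σ : absoluteGaloisGroup ℚ, ∃ a : ℤ,
      ‖((entry S θ σ : padicCoeffIntegers S) : PadicAlgCl p) - (a : PadicAlgCl p)‖ < 1 ∧ ∀ P ∈ Φ, σ • P = a • P) :
    IsTeichmullerLiftOn S (Φ.map (geomTorsion W (p : ℤ)).subtype) θ := by
  refine ⟨hpow, fun σ ↦ ?_⟩
  obtain ⟨a, ha, hΦ⟩ := h σ
  refine ⟨a, ha, ?_⟩
  rintro _ ⟨P, hP, rfl⟩
  rw [AddSubgroup.mem_bot, AddSubgroup.coe_subtype, ← AddSubgroup.torsionBy.coe_smul, hΦ P hP, AddSubgroupClass.coe_zsmul,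
    sub_self]

/-- Writing `IsTeichmullerLiftOnQuot` from torsion-level witnesses. [cite: KellerYin2024, §1.4 (arXiv:2402.12781v2 TeX L1063–1086)] -/
theorem isTeichmullerLiftOnQuot_of_witness {Φ : AddSubgroup (geomTorsion W (p : ℤ))}
    {θ : FramedGaloisRep ℚ (padicCoeffIntegers S) 1} (hpow : ∀ σ : absoluteGaloisGroup ℚ, θ σ ^ (p - 1) = 1)
    (h : ∀ σ : absoluteGaloisGroup ℚ, ∃ b : ℤ,
      ‖((entry S θ σ : padicCoeffIntegers S) : PadicAlgCl p) - (b : PadicAlgCl p)‖ < 1 ∧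
        ∀ Q : geomTorsion W (p : ℤ), σ • Q - b • Q ∈ Φ) :
    IsTeichmullerLiftOnQuot S (Φ.map (geomTorsion W (p : ℤ)).subtype) (geomTorsion W (p : ℤ)) θ := by
  refine ⟨hpow, fun σ ↦ ?_⟩
  obtain ⟨b, hb, hΦ⟩ := h σ
  refine ⟨b, hb, fun P hP ↦ ?_⟩
  refine ⟨σ • (⟨P, hP⟩ : geomTorsion W (p : ℤ)) - b • (⟨P, hP⟩ : geomTorsion W (p : ℤ)), hΦ _, ?_⟩
  rw [AddSubgroup.coe_subtype, AddSubgroupClass.coe_sub, AddSubgroup.torsionBy.coe_smul, AddSubgroupClass.coe_zsmul]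

/-- **Uniqueness of the Teichmüller lift on a rational line** (x1's rigidity `IsTeichmullerLiftOnQuot.eq_of_exists_notMem` with the witness
`P₀ ∈ Φ ∖ 0`). [cite: KellerYin2024, §1.4 (arXiv:2402.12781v2 TeX L1063–1086)] [cite: SerreLocalFields1979, Ch. II §4 Prop. 8] -/
theorem eq_of_isTeichmullerLiftOn {Φ : AddSubgroup (geomTorsion W (p : ℤ))} (hΦ : Nat.card Φ = p)
    {θ θ' : FramedGaloisRep ℚ (padicCoeffIntegers S) 1}
    (h : IsTeichmullerLiftOn S (Φ.map (geomTorsion W (p : ℤ)).subtype) θ)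
    (h' : IsTeichmullerLiftOn S (Φ.map (geomTorsion W (p : ℤ)).subtype) θ') : θ = θ' := by
  obtain ⟨P₀, hP₀Φ, hP₀⟩ := exists_ne_zero_mem hΦ
  refine IsTeichmullerLiftOnQuot.eq_of_exists_notMem h h' (P₀ := (P₀ : geomPoints W)) ⟨P₀, hP₀Φ, rfl⟩ ?_ ?_
  · rw [AddSubgroup.mem_bot]
    exact fun h0 ↦ hP₀ (Subtype.ext h0)
  · rw [← AddSubgroupClass.coe_zsmul, natCast_zsmul_eq_zero P₀]
    exact (⊥ : AddSubgroup (geomPoints W)).zero_mem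

/-- **Uniqueness of the Teichmüller lift on the quotient by a rational line** (rigidity with a witness `P₀ ∈ E[p] ∖ Φ`, which exists as
`#Φ = p < p² = #E[p]`). [cite: KellerYin2024, §1.4 (arXiv:2402.12781v2 TeX L1063–1086)] [cite: SerreLocalFields1979, Ch. II §4 Prop. 8] -/
theorem eq_of_isTeichmullerLiftOnQuot [W.IsElliptic] {Φ : AddSubgroup (geomTorsion W (p : ℤ))} (hΦ : Nat.card Φ = p)
    {θ θ' : FramedGaloisRep ℚ (padicCoeffIntegers S) 1}
    (h : IsTeichmullerLiftOnQuot S (Φ.map (geomTorsion W (p : ℤ)).subtype) (geomTorsion W (p : ℤ)) θ)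
    (h' : IsTeichmullerLiftOnQuot S (Φ.map (geomTorsion W (p : ℤ)).subtype) (geomTorsion W (p : ℤ)) θ') : θ = θ' := by
  obtain ⟨Q₀, hQ₀⟩ := exists_not_mem_of_natCard_eq hΦ
  refine IsTeichmullerLiftOnQuot.eq_of_exists_notMem h h' (P₀ := (Q₀ : geomPoints W)) Q₀.2 ?_ ?_
  · rintro ⟨Q, hQ, hQQ⟩
    rw [AddSubgroup.coe_subtype] at hQQ
    exact hQ₀ (Subtype.ext hQQ ▸ hQ)
  · rw [← AddSubgroupClass.coe_zsmul, natCast_zsmul_eq_zero Q₀]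
    exact (Φ.map (geomTorsion W (p : ℤ)).subtype).zero_mem

/-- **A quotient witness exists** for every rational line `L ≤ E[p]` and every `σ`: an integer `b′` with `σ • Q − b′ • Q ∈ L` on `E[p]`
(read off the Teichmüller pair of `L`, which exists: `exists_teichmullerPair_of_line`). [folklore] -/
theorem exists_quotWitness [W.IsElliptic] {L : AddSubgroup (geomTorsion W (p : ℤ))} (hL : IsRationalLine W p L)
    (σ : absoluteGaloisGroup ℚ) : ∃ b' : ℤ, ∀ Q : geomTorsion W (p : ℤ), σ • Q - b' • Q ∈ L := by
  obtain ⟨-, θq, -, hq⟩ := EisensteinCharacterInvariantsAtThreeCharacterCutEq.exists_teichmullerPair_of_line W p hL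
  obtain ⟨b', -, h⟩ := exists_witness_quot hq σ
  exact ⟨b', h⟩

/-- **Transfer of a quotient witness by the determinant.**  If `σ` acts on the rational line `L ≤ E[p]` by `c` and `c·d ≡ χ̄_p(σ) (mod p)`,
then `d` is a quotient witness for `L`: with any quotient witness `b′` (`exists_quotWitness`) the determinant gives `c·b′ ≡ χ̄_p(σ) ≡ c·d`
(`TwistThreeResidualPair.intCast_mul_eq_cyclotomic_of_stableLine`), `c` is a unit mod `p`, so `b′ ≡ d` and `σQ − dQ = (σQ − b′Q) + (b′ − d)Q ∈ L`.
[cite: Serre1972, §1.11 (det ρ̄_{E,p} = χ̄_p)] -/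
theorem forall_smul_sub_zsmul_mem_of_mul_eq_cyclotomic [W.IsElliptic] {L : AddSubgroup (geomTorsion W (p : ℤ))}
    (hL : IsRationalLine W p L) (σ : absoluteGaloisGroup ℚ) {c d : ℤ} (hc : ∀ P ∈ L, σ • P = c • P)
    (hcd : ((c * d : ℤ) : ZMod p) = ((modPCyclotomicCharacterZMod ℚ p σ : (ZMod p)ˣ) : ZMod p)) :
    ∀ Q : geomTorsion W (p : ℤ), σ • Q - d • Q ∈ L := by
  obtain ⟨b', hb'⟩ := exists_quotWitness hL σ
  have hdet := intCast_mul_eq_cyclotomic_of_stableLine σ hL.1 hc hb'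
  -- `c (b' - d) ≡ 0`, `c` a unit
  have hc0 : (c : ZMod p) ≠ 0 := by
    intro h0
    have : ((c * d : ℤ) : ZMod p) = 0 := by rw [Int.cast_mul, h0, zero_mul]
    rw [this] at hcd
    exact (modPCyclotomicCharacterZMod ℚ p σ).ne_zero hcd.symm
  have hbd : ((b' - d : ℤ) : ZMod p) = 0 := by
    have h1 : (c : ZMod p) * (b' : ZMod p) = (c : ZMod p) * (d : ZMod p) := by
      rw [← Int.cast_mul, ← Int.cast_mul, hdet, hcd]
    rw [Int.cast_sub, sub_eq_zero]
    exact mul_left_cancel₀ hc0 h1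
  have hdvd : (p : ℤ) ∣ b' - d := (ZMod.intCast_zmod_eq_zero_iff_dvd (b' - d) p).mp hbd
  intro Q
  have e : σ • Q - d • Q = (σ • Q - b' • Q) + (b' - d) • Q := by rw [sub_zsmul]; abel
  rw [e, zsmul_eq_zero_of_dvd hdvd Q, add_zero]
  exact hb' Q

end Read

/-! ### §1 Two rational lines of ONE curve carry equal-or-swapped Teichmüller pairs -/

section SameCurve

variable {W : WeierstrassCurve ℚ} [W.IsElliptic] {p : ℕ} [hp : Fact p.Prime] {S : Set (PadicAlgCl p)}

/-- **The residual pair does not depend on the line, up to order.**  Let `Φ, Ψ ≤ E[p]` be rational lines with Teichmüller pairs `(θ₁, θ₂)` and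
`(η₁, η₂)`.  If `Φ = Ψ` the pairs agree (rigidity).  If `Φ ≠ Ψ` then `Φ ⊓ Ψ = 0`, `Φ + Ψ = E[p]`, and the pairs are SWAPPED: for `T ∈ Ψ`
and the quotient witness `b` of `Φ`, `σT − bT ∈ Φ ⊓ Ψ = 0`, so `Γ_ℚ` acts on `Ψ` through `θ₂`; for `Q = P + T` and the witness `a` of `σ` on
`Φ`, `σQ − aQ = σT − aT ∈ Ψ`, so `Γ_ℚ` acts on `E[p]/Ψ` through `θ₁`; rigidity.  (`E[p]^ss ≅ θ₁ ⊕ θ₂` read without semisimplification.)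
[cite: KellerYin2024, §1.4 (arXiv:2402.12781v2 TeX L1063–1086: the characters φ, ψ of ρ̄_f)] [cite: Serre1972, §1.11] -/
theorem teichmullerPair_eq_or_swap_of_isRationalLine
    {Φ : AddSubgroup (geomTorsion W (p : ℤ))} (hΦ : IsRationalLine W p Φ)
    {θ₁ θ₂ : FramedGaloisRep ℚ (padicCoeffIntegers S) 1}
    (h₁ : IsTeichmullerLiftOn S (Φ.map (geomTorsion W (p : ℤ)).subtype) θ₁)
    (h₂ : IsTeichmullerLiftOnQuot S (Φ.map (geomTorsion W (p : ℤ)).subtype) (geomTorsion W (p : ℤ)) θ₂)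
    {Ψ : AddSubgroup (geomTorsion W (p : ℤ))} (hΨ : IsRationalLine W p Ψ)
    {η₁ η₂ : FramedGaloisRep ℚ (padicCoeffIntegers S) 1}
    (k₁ : IsTeichmullerLiftOn S (Ψ.map (geomTorsion W (p : ℤ)).subtype) η₁)
    (k₂ : IsTeichmullerLiftOnQuot S (Ψ.map (geomTorsion W (p : ℤ)).subtype) (geomTorsion W (p : ℤ)) η₂) :
    (η₁ = θ₁ ∧ η₂ = θ₂) ∨ (η₁ = θ₂ ∧ η₂ = θ₁) := by
  by_cases hne : Φ = Ψ
  · subst hne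
    exact Or.inl ⟨eq_of_isTeichmullerLiftOn hΦ.1 k₁ h₁, eq_of_isTeichmullerLiftOnQuot hΦ.1 k₂ h₂⟩
  · right
    obtain ⟨hinf, hsup⟩ := SemistableTwistLocalAnyLine.inf_eq_bot_and_sup_eq_top_of_ne hp.out
      (Literature.NumberTheory.EllipticCurves.Rank1Residual.natCard_geomTorsion W p) hΦ.1 hΨ.1 hne
    -- `Γ_ℚ` acts on `Ψ` through `θ₂`
    have hΨ₂ : IsTeichmullerLiftOn S (Ψ.map (geomTorsion W (p : ℤ)).subtype) θ₂ := by
      refine isTeichmullerLiftOn_of_witness h₂.1 fun σ ↦ ?_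
      obtain ⟨b, hb, hbΦ⟩ := exists_witness_quot h₂ σ
      refine ⟨b, hb, fun T hT ↦ ?_⟩
      have hm : σ • T - b • T ∈ Φ ⊓ Ψ := ⟨hbΦ T, Ψ.sub_mem (hΨ.2 σ T hT) (Ψ.zsmul_mem hT b)⟩
      rw [hinf, AddSubgroup.mem_bot] at hm
      exact sub_eq_zero.mp hm
    -- `Γ_ℚ` acts on `E[p]/Ψ` through `θ₁`
    have hΨ₁ : IsTeichmullerLiftOnQuot S (Ψ.map (geomTorsion W (p : ℤ)).subtype) (geomTorsion W (p : ℤ)) θ₁ := by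
      refine isTeichmullerLiftOnQuot_of_witness h₁.1 fun σ ↦ ?_
      obtain ⟨a, ha, haΦ⟩ := exists_witness_sub h₁ σ
      refine ⟨a, ha, fun Q ↦ ?_⟩
      have hQ : Q ∈ Φ ⊔ Ψ := hsup ▸ AddSubgroup.mem_top Q
      obtain ⟨P, hP, T, hT, rfl⟩ := AddSubgroup.mem_sup.mp hQ
      have e : σ • (P + T) - a • (P + T) = (σ • P - a • P) + (σ • T - a • T) := by
        rw [smul_add, zsmul_add]; abel
      rw [e, haΦ P hP, sub_self, zero_add]
      exact Ψ.sub_mem (hΨ.2 σ T hT) (Ψ.zsmul_mem hT a)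
    exact ⟨eq_of_isTeichmullerLiftOn hΨ.1 k₁ hΨ₂, eq_of_isTeichmullerLiftOnQuot hΨ.1 k₂ hΨ₁⟩

end SameCurve

end Summit.BirchSwinnertonDyer.BirchSwinnertonDyer.Theorems.SchneiderFreeAdditiveX3.ResidualPairIsogeny

end
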